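import Summits.BirchSwinnertonDyer.BirchSwinnertonDyer.Theorems.ErratumRoadFiveNonSurjCornerBranchesDefs
import Summits.BirchSwinnertonDyer.BirchSwinnertonDyer.Theorems.ErratumRoadFiveNonSurjCornerTwinKatoFacts
import HarnessLib

/-!
# Route `ErratumRoadFive` (rung K2, `p ≥ 5`), crux 6 `NonSurjCorner` (item stmt-BirchSwinnertonDyer-19065):
# the GLUE of the proposed split — `nonSurjCorner_of_branches : NonSurjCornerKolyZ → NonSurjCornerKolyJ →
# NonSurjCornerTwinMu → KatoTwinFactsFive → X11aLowerHalf → NonSurjCorner` (cell `bsd-stepL`, seat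
# `bsd-stepL-corner-p1` g6; planner g28 ruling (B) (c1)–(c2); `--supports stmt-BirchSwinnertonDyer-19065`)

The three children are the Theses-free constants of `Theorems/ErratumRoadFiveNonSurjCornerBranchesDefs.lean`
(Zₚᶜ `NonSurjCornerKolyZ`, Jₚᶜ `NonSurjCornerKolyJ`, TwinMu `NonSurjCornerTwinMu`); the fourth binder is the ONE
support bundle `KatoTwinFactsFive` — the twenty-two NAMED facts of the record written as a single conjunction
(verbatim the fact binders of p478491's refined-Kolyvagin theorem, in that order; the planner pastes the same text
as the support child's statement, exactly as `PublishedInputsFive` ∕ `PublishedInputsIMCReduction` are route-file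
conjunctions); the fifth is the route's LOAD-BEARING crux 19064 `X11aLowerHalf` BY NAME. NO aside is consumed
(the Euler-system half comes from the Jetchev branch Jₚᶜ via Cha 2005 Rmk. 25, not from 19062 `EulerHalfOffLocus`,
condition (c1)). The conclusion is the route decl `Theses.ErratumRoadFive.NonSurjCorner` BY NAME, so this module
imports the route file and the planner's `route edit --split NonSurjCorner --into … --glue …` is closed by the
one-line wrapper `nonSurjCornerOfBranches_holds`-style term over this theorem (precedent: item 19284
`openInputIMCOfChildren_holds`; `--glue-by` is unusable for the same reason as there).

Proof: destructure the bundle and call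
`X11b.erratumRoadFive_nonSurjCorner_of_refinedKolyvagin_of_lowerX11a_of_katoFacts_of_twinMuZero` (p478491; chain
g0 p417841/p418376/p418889 → g2 p427393 → g3 p442962/p443501 → g4 p453738/p454452/p456176 → g5 p477282/p478491).

HONEST FRAMING: ONE theorem, pure glue; CONDITIONAL on its five displayed hypotheses (three OPEN branches, a
conjunction of twenty-two named facts two of which are CONSTRUCTION facts of `bsd-2adic`, and the OPEN crux
19064); nothing is asserted about any curve, nothing is booked, item 19065 does NOT close by this file, BSD is not
advanced, no census word moves (T7). Flag `Cha05-Rmk25-structure` (Kolyvagin's structure theorem under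
irreducibility, Cha 2005 Rmk. 25 ∕ Matar–Nekovář 2019 §0.11) rides on the conclusion.

References: [Cha2005] Thm. 21, Rmk. 25 (pp. 173–175); [MatarNekovar2019] §0.9–0.11; [McCallumLMS1991] §5;
[WZhang2014] Thm. 1.1, Rem. 5; [Jetchev2008] Conj. 1.3; [Kato2004Asterisque] Thm. 12.4–12.6, §17.13;
[GreenbergLNM1716] Thm. 1.5, Conj. 1.11; [Wuthrich2014] Cor. 18, Prop. 21; [SteinWuthrich2013] Thm. 6.1.
-/

set_option autoImplicit false
set_option linter.dupNamespace false

noncomputable section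

open scoped Classical NumberField MatrixGroups ModularForm

open CongruenceSubgroup WeierstrassCurve NumberField IsDedekindDomain Field
  Literature.NumberTheory.EllipticCurves
  Literature.NumberTheory.EllipticCurves.ModularForms
  Literature.NumberTheory.EllipticCurves.Rank1Residual
  Literature.NumberTheory.EllipticCurves.Rank1Residual.Typed
  Literature.NumberTheory.EllipticCurves.Wuthrich2014
  Literature.NumberTheory.EllipticCurves.SteinWuthrich2013
  Literature.NumberTheory.EllipticCurves.Greenberg1999
  Literature.NumberTheory.QuadraticFields.Quadratic
  Summit.BirchSwinnertonDyer.Rank1Residual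
  Summit.BirchSwinnertonDyer.Rank1Residual.X11b
  Summit.BirchSwinnertonDyer.Rank1Residual.X11b.Three.Koly

namespace Summit.BirchSwinnertonDyer.BirchSwinnertonDyer.Theorems

/-- **GLUE of the split of crux 6 `NonSurjCorner` (item 19065): Zₚᶜ → Jₚᶜ → TwinMu → `KatoTwinFactsFive` →
`X11aLowerHalf` (19064) → `NonSurjCorner`.** The bundle binder `hF` is the conjunction of the twenty-two named
facts (Gross–Zagier, Kolyvagin, Wuthrich Prop. 21, GZK, modularity ×3, Friedberg–Hoffstein, Mazur, Gross's Galois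
action, `φ(τ) ∈ E(K[1])`, Stein–Wuthrich Thm. 6.1 ×2, Greenberg–Stevens, Cha Rmk. 25 ×2, Kato (12.2.1), Thm. 12.4,
the §17.13 inputs at a non-split ∕ split multiplicative odd prime, Greenberg Thm. 1.5, Wuthrich Cor. 18), verbatim
the text the planner files as the support child `KatoTwinFactsFive`. One line over p478491's
`X11b.erratumRoadFive_nonSurjCorner_of_refinedKolyvagin_of_lowerX11a_of_katoFacts_of_twinMuZero`. CONDITIONAL;
closes nothing by itself. [cite: Cha2005, Thm. 21 and Rmk. 25 (pp. 173–175)]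
[cite: MatarNekovar2019, §0.9 and §0.11 (pp. 456–457)] [cite: McCallumLMS1991, §5 Cor. 5.6 (p. 310)]
[cite: Kato2004Asterisque, Thm. 12.4 (p. 221) and §17.13 (pp. 279–280)] [cite: GreenbergLNM1716, §1 Conj. 1.11 (shape)] -/
theorem nonSurjCorner_of_branches (hZ : NonSurjCornerKolyZ) (hJ : NonSurjCornerKolyJ) (hμ : NonSurjCornerTwinMu)
    (hF :
      (∀ (N : ℕ) [NeZero N] (W : WeierstrassCurve ℚ) (K : Type) [Field K] [NumberField K], gross_zagier N W K) ∧
      (∀ (N : ℕ) [NeZero N] (W : WeierstrassCurve ℚ) (K : Type) [Field K] [NumberField K], kolyvagin N W K) ∧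
      sha_dvd_analyticSha ∧
      rank_eq_analyticRank_of_analyticRank_le_one ∧
      WeierstrassCurve.hasEntireLFunction_rat ∧
      exists_isNewformOf ∧
      nonempty_modularParametrizationData ∧
      friedbergHoffstein_exists_heegnerField_split_twist_ne_zero ∧
      mazur_not_dvd_maninConstant_of_odd ∧
      (∀ (N : ℕ) [NeZero N] (W : WeierstrassCurve ℚ) (K : Type) [Field K] [NumberField K],
        heegnerPointOfConductor_one_galoisConj N W K) ∧
      (∀ (N : ℕ) [NeZero N] (W : WeierstrassCurve ℚ) (K : Type) [Field K] [NumberField K],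
        phi_heegnerTau_mem_singularModuliField N W K) ∧
      thm61_splitMultiplicative ∧
      thm61_nonsplitMultiplicative ∧
      (∀ (W : WeierstrassCurve ℚ) [W.IsElliptic] [W.IsGloballyMinimal] (p : ℕ) [Fact p.Prime],
        greenberg_stevens (W := W) (p := p)) ∧
      Cha2005.rmk25_pow_dvd_card_sha_primary_of_certificate ∧
      Cha2005.rmk25_padicValNat_card_sha_primary_add_le_of_globalDivisibility ∧
      Kato2004.nonempty_iwasawaH1Data ∧
      Kato2004.thm12_4 ∧
      Kato2004.exists_multDivisibilityInputs_nonsplit ∧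
      Kato2004.exists_multDivisibilityInputs_split ∧
      thm15_isTorsion_multiplicative_rat ∧
      Wuthrich2014.corollary18_padicLFunction_mem_iwasawaAlgebra_multiplicative)
    (h₄ : Summit.BirchSwinnertonDyer.BirchSwinnertonDyer.Theses.ErratumRoadFive.X11aLowerHalf) :
    Summit.BirchSwinnertonDyer.BirchSwinnertonDyer.Theses.ErratumRoadFive.NonSurjCorner := by
  obtain ⟨hGZ, hKo, hWu, hGZK, hmod, hnf, hpar, hFHs, hMaz, hrec, hD36, hJs, hJn, hGS, hChaL, hChaU, hne, h12,
    hns, hsp, h15, h18⟩ := hF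
  exact X11b.erratumRoadFive_nonSurjCorner_of_refinedKolyvagin_of_lowerX11a_of_katoFacts_of_twinMuZero hGZ hKo
    hWu hGZK hmod hnf hpar hFHs hMaz hrec hD36 hJs hJn hGS hChaL hChaU hne h12 hns hsp h15 h18 h₄
    (fun W _ _ p _ N _ K _ _ Dt β ι ↦ hZ W p N K Dt β ι) (fun W _ _ _ p _ K _ _ Dt β ι ↦ hJ W p K Dt β ι)
    (fun Wd _ _ p _ ↦ hμ Wd p)

end Summit.BirchSwinnertonDyer.BirchSwinnertonDyer.Theorems

end
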